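import Literature.IUT.HodgeArakelov.ThetaSettingThetaKerGeomNielsenMoveAtModelTate
import Literature.AnabelianGeometry.EtaleTheta.SettingModel2Curve
import HarnessLib

/-!
# ONE-LAW-NEG (B1) «HEXT-KUMMER-NEG», discrete core: the transvection `a^l ↦ a^l·b` on `Ker(Δ → ℤ/l)` COMMUTES with the
# Kummer generator `a ↦ bab, b ↦ b` (proof-only; K-L6 row «ONE-LAW-NEG@modelTate»)

S. Mochizuki, *The étale theta function …* [EtTh], Publ. RIMS **45** (2009), §1 pp. 12–13 (the upper-triangular Galois action on
`Δ_X`: cyclotomic character on `b`, Kummer class of the `q`-parameter in the corner — at the stage-2 Tate model `actχq p 1 2` the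
Kummer generator acts on `F̂₂` by `Inn(b) ∘ shear(2) : a ↦ bab, b ↦ b`) [cite: MochizukiEtTh2009, §1 p.13]; Cor. 2.18 (i) p. 60
[cite: MochizukiEtTh2009, Cor 2.18(i) p.60]; R. C. Lyndon, P. E. Schupp, *Combinatorial Group Theory*, Ch. I Prop. 3.7 (Schreier
basis) [cite: LyndonSchupp2001, Ch. I Prop. 3.7].  Cell `abc-iut`, K-L6 slice, row «ONE-LAW-NEG@modelTate» file B (abc-iut-L6-lead
gen 8, §F v1.19er (B) GO 2026-08-27T07:10Z), seat abc-iut-w5-d169 (gen 13); this is part B1 (discrete), part B2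
(`ThetaSettingHextKummerCompatibleNonExtendableAtModelTate`) transports it to `dUU l` and proves non-extendability.
PROOF-ONLY: no definition, no instance, no new named fact.

* `exists_mem_closure_bConj_pow_eq` — in ANY group, with `B_j := α^j β α^{-j}`: `(βαβ)^k = P · α^k · β` (`k ≥ 1`) for some `P` in the
  subgroup generated by `B_0, …, B_{k−1}` (`P = B_0 B_1² ⋯ B_{k−1}²`); so the Kummer generator `τ : α ↦ βαβ, β ↦ β` acts on the
  `b`-conjugates by `τ(B_k) = P B_k P⁻¹` and on `α^l` by `τ(α^l) = P α^l β` — the nested products that «remember the cyclic order».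
* **`exists_transvection_cyclicKernel`** — on `U = Ker(χ₀ : Δ → ℤ/l)`, free on the Schreier basis `{a^j b a^{-j}}_{j<l} ∪ {a^l}`, the
  elementary Nielsen transformation `T₀ : a^l ↦ a^l · b` (all `a^j b a^{-j}` fixed) is an automorphism which (i) preserves the degree,
  (ii) preserves the `z`-coordinate of `heisHom` mod `l` (`z(a^l b) = l ≡ 0`), (iii) COMMUTES with `τ₀ : a ↦ bab, b ↦ b` restricted to
  `U` (τ₀ preserves `U`; `T₀` fixes the subgroup `V = ⟨a^j b a^{-j} : j < l⟩` pointwise, `τ₀(V-generators) ∈ V`, and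
  `τ₀(a^l) = P · a^l · b` with `P ∈ V`), and (iv) sends `a^l ↦ a^l b`.  Desk origin: this seat's (B2) memo §3 (the simplest GEOMETRIC
  multitwist `T = T_{(0,…,0,1)}` of the `l`-fold cyclic cover; all 124 multitwists at `l = 3` commute with `τ` exactly).

HONEST LABEL.  Statements about the free group `F₂` and OUR semi-synthetic model of the [EtTh] §1 interface; nothing of [EtTh]
(refereed) or [IUTchII] (claim key `Mochizuki2012`, DISPUTED, D-0012) is asserted; no side is taken on [IUTchIII] Cor. 3.12; typed ≠
proved; nothing here says abc is proved or refuted.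
bears_on: LADDER-ABC:A2.L-K (K-L6 «ONE-LAW-NEG@modelTate») → LADDER-FRONTIER F-A2 (M·L6) → rung 0 `Summit.ABC`.
-/

set_option autoImplicit false

noncomputable section

namespace Literature.AnabelianGeometry.EtaleTheta.SettingModel

open Literature.GroupTheory.CombinatorialGroupTheory
open Multiplicative

/-- **The Kummer generator on the `b`-conjugates (a group identity).** In any group, with `B_j := α^j β α^{-j}`:
for `k ≥ 1`, `(βαβ)^k = P · α^k · β` for some `P` in the subgroup generated by `B_0, …, B_{k-1}` (`P = B_0 B_1² ⋯ B_{k-1}²`);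
hence `τ(B_k) = P B_k P⁻¹` and `τ(α^l) = P α^l β` for the automorphism `τ : α ↦ βαβ, β ↦ β`. [folklore] -/
private theorem exists_mem_closure_bConj_pow_eq {G : Type*} [Group G] (α β : G) (k : ℕ) (hk : 1 ≤ k) :
    ∃ P ∈ Subgroup.closure ((fun j : ℕ => α ^ j * β * (α ^ j)⁻¹) '' {j | j < k}),
      (β * α * β) ^ k = P * α ^ k * β := by
  induction k with
  | zero => omega
  | succ k ih =>
    rcases Nat.eq_zero_or_pos k with h0 | hpos
    · subst h0
      have hmem : β ∈ (fun j : ℕ => α ^ j * β * (α ^ j)⁻¹) '' {j | j < 0 + 1} :=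
        (Set.mem_image _ _ _).mpr ⟨0, by simp, by simp⟩
      exact ⟨β, Subgroup.subset_closure hmem, by simp⟩
    · obtain ⟨P, hP, hPk⟩ := ih hpos
      refine ⟨P * (α ^ k * β * (α ^ k)⁻¹) ^ 2, ?_, ?_⟩
      · refine Subgroup.mul_mem _ (Subgroup.closure_mono (Set.image_mono fun j (hj : j < k) => ?_) hP)
          (Subgroup.pow_mem _ (Subgroup.subset_closure ((Set.mem_image _ _ _).mpr ⟨k, by simp, rfl⟩)) 2)
        simp only [Set.mem_setOf_eq] at hj ⊢
        omega
      · rw [pow_succ, hPk, pow_succ α k]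
        simp only [pow_two, mul_assoc, inv_mul_cancel_left]

/-- **The discrete transvection `T₀ : a^l ↦ a^l · b` on `U = Ker(Δ → ℤ/l)`** (all `b_j := a^j b a^{-j}`, `j < l`, fixed; Schreier
basis of [LyndonSchupp2001]): an automorphism of `U` preserving the degree and the `z`-coordinate mod `l`, COMMUTING with the
Kummer generator `τ₀ : a ↦ bab, b ↦ b` restricted to `U`, and sending `a^l ↦ a^l b`. [cite: LyndonSchupp2001, Ch. I Prop. 3.7] -/
theorem exists_transvection_cyclicKernel (l : ℕ+) (hl : 3 ≤ (l : ℕ)) (χ₀ : F₂ →* Multiplicative (ZMod l))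
    (hχ₀ : ∀ i, χ₀ (FreeGroup.of i) = if i = 0 then ofAdd (1 : ZMod l) else 1)
    (τ₀ : F₂ →* F₂) (hτ₀a : τ₀ (FreeGroup.of 0) = FreeGroup.of 1 * FreeGroup.of 0 * FreeGroup.of 1)
    (hτ₀b : τ₀ (FreeGroup.of 1) = FreeGroup.of 1) :
    ∃ T₀ : (χ₀.comp Del.val).ker ≃* (χ₀.comp Del.val).ker,
      (∀ u : (χ₀.comp Del.val).ker, expA (Del.val ((T₀ u : (χ₀.comp Del.val).ker) : Del)) = expA (Del.val (u : Del))) ∧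
      (∀ u : (χ₀.comp Del.val).ker, (((heisHom (Del.val ((T₀ u : (χ₀.comp Del.val).ker) : Del))).z : ℤ) : ZMod l) =
        (((heisHom (Del.val (u : Del))).z : ℤ) : ZMod l)) ∧
      (∀ u : (χ₀.comp Del.val).ker, Del.ofF₂ (τ₀ (Del.val (u : Del))) ∈ (χ₀.comp Del.val).ker) ∧
      (∀ u v : (χ₀.comp Del.val).ker, Del.val (v : Del) = τ₀ (Del.val (u : Del)) →
        Del.val ((T₀ v : (χ₀.comp Del.val).ker) : Del) = τ₀ (Del.val ((T₀ u : (χ₀.comp Del.val).ker) : Del))) ∧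
      ∃ A₀ : (χ₀.comp Del.val).ker, Del.val (A₀ : Del) = FreeGroup.of 0 ^ (l : ℕ) ∧
        Del.val ((T₀ A₀ : (χ₀.comp Del.val).ker) : Del) = FreeGroup.of 0 ^ (l : ℕ) * FreeGroup.of 1 := by
  classical
  haveI : NeZero (l : ℕ) := ⟨l.ne_zero⟩
  haveI : Fact (1 < (l : ℕ)) := ⟨by omega⟩
  -- bases (as in file 1)
  let eD : Del ≃* F₂ := MulEquiv.ofBijective Del.val Del.val_bijective
  let bD : FreeGroupBasis (Fin 2) Del := FreeGroupBasis.ofRepr eD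
  have hbD : ∀ i, Del.val (bD i) = FreeGroup.of i := fun i => by
    change eD (eD.symm (FreeGroup.of i)) = FreeGroup.of i
    exact eD.apply_symm_apply _
  set χD : Del →* Multiplicative (ZMod l) := χ₀.comp Del.val with hχD
  have hχ : ∀ x, χD (bD x) = if x = 0 then ofAdd (1 : ZMod l) else 1 := fun x => by
    rw [hχD, MonoidHom.comp_apply, hbD, hχ₀]
  obtain ⟨bK, hbKl, hbKr⟩ := FreeGroupBasis.exists_freeGroupBasis_cyclicKernel bD (0 : Fin 2) l χD hχ
  let β : {x : Fin 2 // x ≠ 0} := ⟨1, one_ne_zero⟩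
  have hβ : ∀ x : {x : Fin 2 // x ≠ 0}, x = β := fun x => by
    rcases x with ⟨x, hx⟩
    refine Subtype.ext ?_
    change x = 1
    fin_cases x
    · exact absurd rfl hx
    · rfl
  let I : Type := ({x : Fin 2 // x ≠ 0} × ZMod l) ⊕ Unit
  let g0 : FreeGroup I := FreeGroup.of (Sum.inl (β, 0))
  let A : FreeGroup I := FreeGroup.of (Sum.inr ())
  -- the transvection and its inverse on the free group
  let f : FreeGroup I → (I → FreeGroup I) := fun c i =>
    match i with
    | Sum.inl (x, a) => FreeGroup.of (Sum.inl (x, a))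
    | Sum.inr _ => A * c
  let TF : FreeGroup I →* FreeGroup I := FreeGroup.lift (f g0)
  let TF' : FreeGroup I →* FreeGroup I := FreeGroup.lift (f g0⁻¹)
  have hTF_inl : ∀ (x : {x : Fin 2 // x ≠ 0}) (a : ZMod l),
      TF (FreeGroup.of (Sum.inl (x, a))) = FreeGroup.of (Sum.inl (x, a)) := fun x a => FreeGroup.lift_apply_of
  have hTF'_inl : ∀ (x : {x : Fin 2 // x ≠ 0}) (a : ZMod l),
      TF' (FreeGroup.of (Sum.inl (x, a))) = FreeGroup.of (Sum.inl (x, a)) := fun x a => FreeGroup.lift_apply_of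
  have hTF_A : TF A = A * g0 := FreeGroup.lift_apply_of
  have hTF'_A : TF' A = A * g0⁻¹ := FreeGroup.lift_apply_of
  have h1 : TF'.comp TF = MonoidHom.id _ := by
    refine FreeGroup.ext_hom _ _ fun i => ?_
    rw [MonoidHom.comp_apply, MonoidHom.id_apply]
    rcases i with ⟨x, a⟩ | ⟨⟩
    · rw [hTF_inl, hTF'_inl]
    · change TF' (TF A) = A
      rw [hTF_A, map_mul, hTF'_A]
      change A * g0⁻¹ * TF' (FreeGroup.of (Sum.inl (β, 0))) = A
      rw [hTF'_inl, mul_assoc, inv_mul_cancel, mul_one]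
  have h2 : TF.comp TF' = MonoidHom.id _ := by
    refine FreeGroup.ext_hom _ _ fun i => ?_
    rw [MonoidHom.comp_apply, MonoidHom.id_apply]
    rcases i with ⟨x, a⟩ | ⟨⟩
    · rw [hTF'_inl, hTF_inl]
    · change TF (TF' A) = A
      rw [hTF'_A, map_mul, hTF_A, map_inv]
      change A * g0 * (TF (FreeGroup.of (Sum.inl (β, 0))))⁻¹ = A
      rw [hTF_inl, mul_assoc, mul_inv_cancel, mul_one]
  let TE : FreeGroup I ≃* FreeGroup I := MonoidHom.toMulEquiv TF TF' h1 h2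
  let T₀ : χD.ker ≃* χD.ker := bK.repr.trans (TE.trans bK.repr.symm)
  have hb : ∀ i, bK.repr.symm (FreeGroup.of i) = bK i := fun i => rfl
  have hT₀ : ∀ i, T₀ (bK i) = bK.repr.symm (TF (FreeGroup.of i)) := fun i => by
    change bK.repr.symm (TF (bK.repr (bK i))) = _
    rw [FreeGroupBasis.repr_apply_coe]
  have hT₀_inl : ∀ (x : {x : Fin 2 // x ≠ 0}) (a : ZMod l), T₀ (bK (Sum.inl (x, a))) = bK (Sum.inl (x, a)) :=
    fun x a => by rw [hT₀, hTF_inl, hb]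
  have hT₀_A : T₀ (bK (Sum.inr ())) = bK (Sum.inr ()) * bK (Sum.inl (β, 0)) := by
    rw [hT₀]
    change bK.repr.symm (TF A) = _
    rw [hTF_A, map_mul, hb, hb]
  -- values in `F₂`
  have hval : ∀ k : ℕ, k < (l : ℕ) → ((k : ZMod l)).val = k := fun k hk => by
    rw [ZMod.val_natCast, Nat.mod_eq_of_lt hk]
  have hvK : ∀ k : ℕ, k < (l : ℕ) → Del.val ((bK (Sum.inl (β, (k : ZMod l))) : Del)) =
      FreeGroup.of 0 ^ k * FreeGroup.of 1 * (FreeGroup.of 0 ^ k)⁻¹ := fun k hk => by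
    rw [hbKl, map_mul, map_mul, map_inv, map_pow, hbD, hbD, hval k hk]
  have hvK' : ∀ a : ZMod l, Del.val ((bK (Sum.inl (β, a))) : Del) =
      FreeGroup.of 0 ^ a.val * FreeGroup.of 1 * (FreeGroup.of 0 ^ a.val)⁻¹ := fun a => by
    rw [hbKl, map_mul, map_mul, map_inv, map_pow, hbD, hbD]
  have hvA : Del.val ((bK (Sum.inr ())) : Del) = FreeGroup.of 0 ^ (l : ℕ) := by rw [hbKr, map_pow, hbD]
  have hv0 : Del.val ((bK (Sum.inl (β, 0))) : Del) = FreeGroup.of 1 := by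
    have := hvK 0 (by omega)
    rw [Nat.cast_zero] at this
    rw [this, pow_zero, one_mul, inv_one, mul_one]
  -- the subgroup `V = ⟨b_0, …, b_{l-1}⟩` of `U`, fixed pointwise by `T₀`
  let V : Subgroup χD.ker := Subgroup.closure (Set.range fun a : ZMod l => bK (Sum.inl (β, a)))
  have hTV : ∀ v ∈ V, T₀ v = v := by
    intro v hv
    refine Subgroup.closure_induction (fun x hx => ?_) (map_one _) (fun x y _ _ hx hy => ?_)
      (fun x _ hx => ?_) hv
    · obtain ⟨a, rfl⟩ := hx
      exact hT₀_inl β a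
    · rw [map_mul, hx, hy]
    · rw [map_inv, hx]
  -- `V` seen in `F₂`: it contains every `a^j b a^{-j}` with `j < l`
  have hVval : ∀ j : ℕ, j < (l : ℕ) → ∃ v ∈ V, Del.val (v : Del) = FreeGroup.of 0 ^ j * FreeGroup.of 1 * (FreeGroup.of 0 ^ j)⁻¹ :=
    fun j hj => ⟨bK (Sum.inl (β, (j : ZMod l))), Subgroup.subset_closure ⟨(j : ZMod l), rfl⟩, hvK j hj⟩
  have hVclos : ∀ k : ℕ, k ≤ (l : ℕ) → ∀ P ∈ Subgroup.closure
      ((fun j : ℕ => FreeGroup.of (0 : Fin 2) ^ j * FreeGroup.of 1 * (FreeGroup.of 0 ^ j)⁻¹) '' {j | j < k}),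
      ∃ v ∈ V, Del.val (v : Del) = P := by
    intro k hk P hP
    refine Subgroup.closure_induction (fun x hx => ?_) ⟨1, V.one_mem, by simp⟩ (fun x y _ _ hx hy => ?_)
      (fun x _ hx => ?_) hP
    · obtain ⟨j, hj, rfl⟩ := hx
      exact hVval j (lt_of_lt_of_le hj hk)
    · obtain ⟨v, hv, rfl⟩ := hx
      obtain ⟨w, hw, rfl⟩ := hy
      exact ⟨v * w, V.mul_mem hv hw, by rw [Subgroup.coe_mul, map_mul]⟩
    · obtain ⟨v, hv, rfl⟩ := hx
      exact ⟨v⁻¹, V.inv_mem hv, by rw [Subgroup.coe_inv, map_inv]⟩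
  have hinj : ∀ u v : χD.ker, Del.val (u : Del) = Del.val (v : Del) → u = v :=
    fun u v h => Subtype.ext (Del.val_bijective.1 h)
  -- `τ₀` on the basis: `τ₀(b_k) ∈ V`, `τ₀(a^l) = P a^l b` with `P ∈ V`
  have hτpow : ∀ n : ℕ, τ₀ (FreeGroup.of 0 ^ n) = (FreeGroup.of 1 * FreeGroup.of 0 * FreeGroup.of 1) ^ n := fun n => by
    rw [map_pow, hτ₀a]
  have hτB : ∀ k : ℕ, k < (l : ℕ) → ∃ v ∈ V, Del.val (v : Del) =
      τ₀ (FreeGroup.of 0 ^ k * FreeGroup.of 1 * (FreeGroup.of 0 ^ k)⁻¹) := by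
    intro k hk
    rcases Nat.eq_zero_or_pos k with h0 | hpos
    · subst h0
      refine ⟨bK (Sum.inl (β, 0)), Subgroup.subset_closure ⟨0, rfl⟩, ?_⟩
      rw [hv0, pow_zero, one_mul, inv_one, mul_one, hτ₀b]
    · obtain ⟨P, hP, hPk⟩ := exists_mem_closure_bConj_pow_eq (FreeGroup.of (0 : Fin 2)) (FreeGroup.of 1) k hpos
      obtain ⟨v, hv, hvP⟩ := hVclos k hk.le P hP
      obtain ⟨w, hw, hwk⟩ := hVval k hk
      refine ⟨v * w * v⁻¹, V.mul_mem (V.mul_mem hv hw) (V.inv_mem hv), ?_⟩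
      rw [Subgroup.coe_mul, Subgroup.coe_mul, Subgroup.coe_inv, map_mul, map_mul, map_inv, hvP, hwk, map_mul, map_mul,
        map_inv, hτpow, hτ₀b, hPk]
      simp only [mul_inv_rev, mul_assoc, mul_inv_cancel_left]
  have hτA : ∃ v ∈ V, Del.val (v : Del) * (FreeGroup.of 0 ^ (l : ℕ) * FreeGroup.of 1) = τ₀ (FreeGroup.of 0 ^ (l : ℕ)) := by
    obtain ⟨P, hP, hPl⟩ := exists_mem_closure_bConj_pow_eq (FreeGroup.of (0 : Fin 2)) (FreeGroup.of 1) l (by omega)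
    obtain ⟨v, hv, hvP⟩ := hVclos l le_rfl P hP
    exact ⟨v, hv, by rw [hvP, hτpow, hPl, mul_assoc]⟩
  -- `τ₀` preserves `U`
  have hχτ : χ₀.comp τ₀ = χ₀ := by
    refine FreeGroup.ext_hom _ _ fun i => ?_
    rw [MonoidHom.comp_apply]
    fin_cases i
    · change χ₀ (τ₀ (FreeGroup.of 0)) = χ₀ (FreeGroup.of 0)
      rw [hτ₀a, map_mul, map_mul, hχ₀, hχ₀]
      simp
    · change χ₀ (τ₀ (FreeGroup.of 1)) = χ₀ (FreeGroup.of 1)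
      rw [hτ₀b]
  have hτmem : ∀ u : χD.ker, Del.ofF₂ (τ₀ (Del.val (u : Del))) ∈ χD.ker := fun u => by
    change χ₀ (Del.val (Del.ofF₂ (τ₀ (Del.val (u : Del))))) = 1
    rw [Del.val_ofF₂, ← MonoidHom.comp_apply, hχτ]
    exact u.2
  refine ⟨T₀, fun u => ?_, fun u => ?_, hτmem, ?_, ⟨bK (Sum.inr ()), hvA, ?_⟩⟩
  · -- (i) degree
    have key : (expA.comp (Del.val.comp χD.ker.subtype)).comp T₀.toMonoidHom = expA.comp (Del.val.comp χD.ker.subtype) := by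
      refine bK.ext_hom _ _ fun i => ?_
      rw [MonoidHom.comp_apply, MulEquiv.coe_toMonoidHom]
      rcases i with ⟨x, a⟩ | ⟨⟩
      · rw [hT₀_inl]
      · rw [hT₀_A]
        change expA (Del.val ((bK (Sum.inr ()) * bK (Sum.inl (β, 0)) : χD.ker) : Del)) = expA (Del.val ((bK (Sum.inr ())) : Del))
        rw [Subgroup.coe_mul, map_mul, map_mul, hv0, expA_apply (FreeGroup.of 1), heisHom_of_one]
        simp
    exact DFunLike.congr_fun key u
  · -- (ii) z mod l
    have hmemU : ∀ d : Del, d ∈ χD.ker → (((heisHom (Del.val d)).x : ℤ) : ZMod l) = 0 := fun d hd => by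
      have h := chi0_eq_heisHom_x l χ₀ hχ₀ (Del.val d)
      rw [show χ₀ (Del.val d) = 1 from hd] at h
      simpa using congrArg toAdd h.symm
    let zl : χD.ker →* Multiplicative (ZMod l) :=
      { toFun := fun u => ofAdd (((heisHom (Del.val (u : Del))).z : ZMod l))
        map_one' := by simp
        map_mul' := fun u v => by
          have hu : (((heisHom (Del.val (u : Del))).x : ℤ) : ZMod l) = 0 := hmemU _ u.2
          rw [← ofAdd_add, Subgroup.coe_mul, map_mul, map_mul, Heis.mul_z, Int.cast_add, Int.cast_add, Int.cast_mul,
            hu, zero_mul, add_zero] }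
    have hzl : ∀ u : χD.ker, zl u = ofAdd (((heisHom (Del.val (u : Del))).z : ZMod l)) := fun _ => rfl
    have key : zl.comp T₀.toMonoidHom = zl := by
      refine bK.ext_hom _ _ fun i => ?_
      rw [MonoidHom.comp_apply, MulEquiv.coe_toMonoidHom]
      rcases i with ⟨x, a⟩ | ⟨⟩
      · rw [hT₀_inl]
      · rw [hT₀_A, map_mul, hzl (bK (Sum.inl (β, 0))), hv0, heisHom_of_one]
        simp
    have := DFunLike.congr_fun key u
    rw [MonoidHom.comp_apply, MulEquiv.coe_toMonoidHom, hzl, hzl] at this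
    exact ofAdd.injective this
  · -- (iii) commutation with `τ₀`
    let τU : χD.ker →* χD.ker :=
      { toFun := fun u => ⟨Del.ofF₂ (τ₀ (Del.val (u : Del))), hτmem u⟩
        map_one' := Subtype.ext (by simp)
        map_mul' := fun u v => Subtype.ext (by simp [map_mul]) }
    have hτU : ∀ u : χD.ker, Del.val ((τU u : χD.ker) : Del) = τ₀ (Del.val (u : Del)) := fun u => rfl
    -- the two composites agree on the basis
    have key : T₀.toMonoidHom.comp τU = τU.comp T₀.toMonoidHom := by
      refine bK.ext_hom _ _ fun i => ?_
      cases i with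
      | inl xa =>
        obtain ⟨x, a⟩ := xa
        obtain rfl := hβ x
        change T₀ (τU (bK (Sum.inl (β, a)))) = τU (T₀ (bK (Sum.inl (β, a))))
        rw [hT₀_inl]
        -- `τU (b_a) ∈ V`, fixed by `T₀`
        obtain ⟨v, hv, hvτ⟩ := hτB a.val (ZMod.val_lt a)
        have hveq : τU (bK (Sum.inl (β, a))) = v := hinj _ _ (by rw [hτU, hvK', hvτ])
        rw [hveq, hTV v hv]
      | inr u =>
        obtain ⟨⟩ := u
        change T₀ (τU (bK (Sum.inr ()))) = τU (T₀ (bK (Sum.inr ())))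
        -- on `A`: `τU A = P·A·B_0`, `P ∈ V`
        obtain ⟨v, hv, hvA'⟩ := hτA
        have hτUA : τU (bK (Sum.inr ())) = v * (bK (Sum.inr ()) * bK (Sum.inl (β, 0))) := hinj _ _ (by
          rw [hτU, hvA, Subgroup.coe_mul, Subgroup.coe_mul, map_mul, map_mul, hvA, hv0, hvA'])
        rw [hτUA, hT₀_A, map_mul, map_mul, hTV v hv, hT₀_A, hT₀_inl, map_mul]
        refine hinj _ _ ?_
        simp only [Subgroup.coe_mul, map_mul, hτU, hv0, hτ₀b, mul_assoc]
        rw [hvA, ← hvA']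
        simp only [mul_assoc]
    intro u v huv
    have hvu : v = τU u := hinj _ _ (by rw [huv, hτU])
    rw [hvu]
    have key' : T₀ (τU u) = τU (T₀ u) := DFunLike.congr_fun key u
    rw [key', hτU]
  · -- (iv) the value on `a^l`
    rw [hT₀_A, Subgroup.coe_mul, map_mul, hvA, hv0]

end Literature.AnabelianGeometry.EtaleTheta.SettingModel

end
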